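import Summits.Ventures.HodgeRepro2.T5GramSignature

/-!
# The field of record `ℚ(ζ₇)`: Lemma N.1's isometry from the selection rule, the sign sums and Landherr alone
(cell pub-hodge-repro2, seat p3)

Tier-5 N2 support, row N2.8.1 (iii) on the field of record. File 156 showed that on `ℚ(ζ₇)` the chain needs
neither `|D| ≤ 1` nor Hilbert reciprocity (the dyadic place splits, file 145); file 158 showed that seat t6-p5's
sign-sum hypothesis is the chain's real-place input. Composed:

* **`exists_isometry_pairForm_K7`**: for totally real non-zero `c₁ c₂ c₁' c₂' ∈ ℚ(ζ₇)` with equal sign sums under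
  every `φ : ℚ(ζ₇) →+* ℂ`, the selection rule's local congruence at the (non-dyadic) non-split places of `ℚ(ζ₇)⁺`
  and Landherr's uniqueness (the one display) give `g : K7 × K7 ≃ₗ[K7] K7 × K7` with
  `pairForm c₁' c₂' (g v) (g w) = pairForm c₁ c₂ v w`.

Mathlib + this seat's files 145 / 156 / 157 / 158 and their imports; no display; no device.
§8(d): uses an L-value-free non-vanishing device: NO.
-/

namespace Summit.Ventures.HodgeRepro2.T5GramSignatureK7

open Matrix IsDedekindDomain IsDedekindDomain.HeightOneSpectrum NumberField NumberField.IsCMField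
open Summit.Ventures.HodgeRepro2.CyclotomicSeven Summit.Ventures.HodgeRepro2.T5HermitianDetClass
  Summit.Ventures.HodgeRepro2.T5HermitianGlobalChain Summit.Ventures.HodgeRepro2.T5GramIsometry
  Summit.Ventures.HodgeRepro2.T5GramSignature Summit.Ventures.HodgeRepro2.T5DatumSimilitude

/-- **Lemma N.1's isometry on `ℚ(ζ₇)`, modulo the selection rule and Landherr alone:** no `|D| ≤ 1`, no Hilbert
reciprocity (the dyadic place of `ℚ(ζ₇)⁺` splits in `ℚ(ζ₇)`, file 145). -/
theorem exists_isometry_pairForm_K7 {c₁ c₂ c₁' c₂' : K7}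
    (h₁ : star c₁ = c₁) (h₂ : star c₂ = c₂) (h₁' : star c₁' = c₁') (h₂' : star c₂' = c₂')
    (hc₁ : c₁ ≠ 0) (hc₂ : c₂ ≠ 0) (hc₁' : c₁' ≠ 0) (hc₂' : c₂' ≠ 0)
    (hsign : ∀ φ : K7 →+* ℂ, (SignType.sign (φ c₁).re : ℤ) + SignType.sign (φ c₂).re =
      (SignType.sign (φ c₁').re : ℤ) + SignType.sign (φ c₂').re)
    (hodd : ∀ v : HeightOneSpectrum (𝓞 (maximalRealSubfield K7)),
      ¬ IsSquare (algebraMap (maximalRealSubfield K7) (v.adicCompletion (maximalRealSubfield K7)) (-7)) →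
      IsUnit (2 : adicCompletionIntegers (maximalRealSubfield K7) v) →
      LocallyCongruent K7 v (diagonal ![c₁', c₂']) (diagonal ![c₁, c₂]))
    (hLandherr : GrossBH2021_Thm3_1_uniqueness K7 (Fin 2)) :
    ∃ g : (K7 × K7) ≃ₗ[K7] (K7 × K7), ∀ v w, pairForm c₁' c₂' (g v) (g w) = pairForm c₁ c₂ v w := by
  have hH : (diagonal ![c₁', c₂']).IsHermitian := by
    refine isHermitian_diagonal_iff.mpr fun i => ?_
    fin_cases i
    · exact h₁'
    · exact h₂'
  have hH' : (diagonal ![c₁, c₂]).IsHermitian := by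
    refine isHermitian_diagonal_iff.mpr fun i => ?_
    fin_cases i
    · exact h₁
    · exact h₂
  have hdet : IsUnit (diagonal ![c₁', c₂']).det := by
    rw [det_diagonal, Fin.prod_univ_two]
    simp [hc₁', hc₂']
  have hdet' : IsUnit (diagonal ![c₁, c₂]).det := by
    rw [det_diagonal, Fin.prod_univ_two]
    simp [hc₁, hc₂]
  exact exists_isometry_pairForm_of_isCongruent
    (isCongruent_of_chain_K7 hH hH' hdet hdet' hodd
      (fun φ => isCongruent_map_of_sign_add φ h₁ h₂ h₁' h₂' hc₁ hc₂ hc₁' hc₂' (hsign φ)) hLandherr)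

end Summit.Ventures.HodgeRepro2.T5GramSignatureK7
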